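import Summits.QuantumFields.YangMills.Theorems.BalabanUVNodesN15KingModelToronMasslessResolvent
import Literature.MathematicalPhysics.QuantumFieldTheory.King1986.EffectiveLaplacianRate
import HarnessLib

/-!
# BalabanUVNodes ∕ N15 — THE KING-MODEL RUNG (PART Ͷ-j): N15's CURRENCY AT A TORON — the twisted fine symbol IS King's §4 lattice symbol `Δ^η(p)` (4.4) AT THE SHIFTED PHYSICAL
# MOMENTUM `p = (p′(q) + φ)∕η`, so King's Lemma 4.1 inputs (4.7)∕(4.8)∕(4.10) — the tree's `latticeSymbol_inv_sub_ref_le`, `latticeSymbol_ge_jordan`, `latticeSymbol_ge_quartic` —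
# hold at a flat connection VERBATIM: `|(−cΔ_ω+m²)^(q)⁻¹ − (|p|²+m²)⁻¹| ≤ (π²∕48)η²` per mode, and the inverse holonomy gap has the η-rate `(π²∕48)η²` UNIFORMLY in the holonomy
# (Track A, DAG node N15 = NE2 «η-rates of the covariance pieces»; FAN-OUT v1.1 §N15 s3 «KING-MODEL RUNG … + what the curved case adds»; count-neutral)

HONEST FRAMING.  Count-neutral (cell `pub-ymgap`, seat `pub-ymgap-dag-n15-e` g44; `--supports stmt-QuantumFields-27247 --as helper` = K3ᴬ, KEY MAP v3).  One finite torus with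
`K_μ` sites of spacing `η` (`c = η⁻²`); King's `A = 0` model [King1986] is the comparison object; constant abelian (flat) `U(1)` link fields.  The η-rate is the SYMBOL-LEVEL (plane
wave by plane wave) comparison of the fine covariance with its continuum value — King's (4.7), the input of his Lemma 4.1 ∕ Prop. 3.10; NOT [Balaban1985BackgroundPropagators] (3.42)
for Bałaban's `G_k(U)` (the block-averaged effective Laplacian at a toron — King's (4.5) with twisted averages — is LOCATED, not typed: see HONEST SCOPE); NOT a node discharge; nothing
continuum-YM ∕ ℝ⁴ ∕ OS ∕ Clay.

THE RESULTS (`η ≠ 0`, `c = (η²)⁻¹`; King's §4 letters `fdSymbol η x = 4η⁻²sin²(ηx∕2)`, `latticeSymbol η M p = Σ_μ fdSymbol η p_μ + M`, `momSq p = Σ_μ p_μ²` of the tree's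
`King1986.EffectiveLaplacianRate`):
* §1 ★★ **`lapSymTw_eq_latticeSymbol`** — THE DICTIONARY: `lapSymTw K (η²)⁻¹ m² φ q = latticeSymbol η m² ((p′(q) + φ)∕η)`: the twisted fine symbol of PART Ͷ-a IS King's (4.4)
  `Δ^η(p) + m²` at the physical momentum `p_μ = (p′_μ(q) + φ_μ)∕η` shifted by the holonomy (`φ_μ∕η = θ_μ∕ℓ_μ`); `holonomyGap_eq_latticeSymbol` (the gap is `Δ^η(θ∕ℓ)` at `M = 0`);
* §2 KING's (4.7)∕(4.8)∕(4.10) AT THE TORON, BY NAME: ★★★ **`abs_inv_lapSymTw_sub_inv_continuum_le`** — `|lapSymTw(q)⁻¹ − (|p|² + m²)⁻¹| ≤ (π²∕48)·η²` for every mode with `p ≠ 0`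
  on the Brillouin zone (`|p′_μ(q)+φ_μ| ≤ π`; `m² ≥ 0`) — the η-RATE OF THE TORON COVARIANCE, MODE BY MODE, with King's constant; ★★ `lapSymTw_ge_jordan_momSq` ((4.8):
  `(4∕π²)|p|² + m² ≤ lapSymTw`), ★★ `abs_lapSymTw_sub_continuum_le'` ((4.10) with the sharp constant `η²∕12`, improving PART Ͷ-d's `5∕48`);
* §3 ★★★ **`abs_inv_holonomyGap_sub_inv_continuum_le`** — THE INVERSE HOLONOMY GAP HAS AN η-RATE UNIFORM IN THE HOLONOMY: for reduced `θ ≠ 0`,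
  `|holonomyGap⁻¹ − (cΣ_μ(θ_μ∕K_μ)²)⁻¹| ≤ (π²∕48)·η²` — although both terms blow up like `(ℓ∕θ)²` as the holonomy is switched off (PART Ͷ-e), their DIFFERENCE is `O(η²)` uniformly
  ((4.7) at `M = 0`, `p = θ∕ℓ`); ★★ `abs_l2_opNorm_massless_inv_sub_le` — the same for `‖(−cΔ_ω)⁻¹‖_{ℓ²→ℓ²}` (PART Ͷ-e `l2_opNorm_toronOp_massless_inv_eq`).

HONEST SCOPE ∕ LOCATED.  King's Prop. 3.10 ∕ (3.91)–(3.93) concern the block-averaged effective Laplacian `Δ^{(k)}` ((4.5)); its toron analogue needs the TWISTED averages `Q^ω` of the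
tree's `B5ToronOperators118`∕`B5ToronMomentum161` (`dft_QsOpTw`, `masterTw`: every twisted symbol is the flat one at `s′ = p′ + nφ`) and the operator identification of
`King1986.EffectiveLaplacianSymbol` redone with them — NOT done here; once it is, the tree's symbol-level Lemmas 4.1–4.3 (`abs_effSymbol_sub_le_of_ref`, `lemma42`, `prop310_rate`), stated
for arbitrary real momenta, apply at `s′` without change.  PRIOR TREE ART (by name): Ͷ-a (`lapSymTw`), Ͷ-d (`holonomyGap`, `redPhase`, `lapSymTw_reduced_zero`, `holonomyGap_pos_iff`,
`period_pos`, `sum_sq_redPhase_pos` via Ͷ-e — restated locally as needed), `King1986.EffectiveLaplacianRate` (`fdSymbol`, `latticeSymbol`, `momSq`, `latticeSymbol_inv_sub_ref_le`, `latticeSymbol_le`,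
`latticeSymbol_ge_jordan`, `latticeSymbol_ge_quartic`), `B5Prop11Plancherel.sOf`.  Dedup (rg at filing): basename 0 files; needles `lapSymTw_eq_latticeSymbol|abs_inv_lapSymTw_sub|abs_inv_holonomyGap_sub`
0 tree files.  Locators: [King1986] (4.4) p.670, (4.7)–(4.10) p.671, Prop. 3.10 (3.91) p.669; [Balaban1984PropagatorsI] (1.31) p.23; [tHooft1979Flux] NPB 153 (notion only).  0 `sorry`, 0 `def`.
-/

noncomputable section

open scoped BigOperators
open Finset

namespace Summit.QuantumFields.YangMills.BalabanUVNodes.N15KingModelRung.Toron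

open Literature.MathematicalPhysics.QuantumFieldTheory.Balaban1983to89.B5Prop11Plancherel
open Literature.MathematicalPhysics.QuantumFieldTheory.King1986 (fdSymbol latticeSymbol momSq latticeSymbol_inv_sub_ref_le latticeSymbol_le latticeSymbol_ge_jordan
  latticeSymbol_ge_quartic momSq_nonneg)

variable {d : ℕ} (K : Fin (d + 1) → ℕ)

/-! ## §1 The dictionary with King's §4 lattice symbol -/
section Dictionary

/-- `(η²)⁻¹(2 − 2cos t) = 4η⁻²sin²(η(t∕η)∕2)` — one coordinate of the dictionary. [cite: King1986, (4.4) p.670] -/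
theorem inv_sq_mul_two_sub_two_cos {η : ℝ} (hη : η ≠ 0) (t : ℝ) : (η ^ 2)⁻¹ * (2 - 2 * Real.cos t) = fdSymbol η (t / η) := by
  unfold fdSymbol
  rw [show η * (t / η) / 2 = t / 2 by field_simp, Real.sin_sq_eq_half_sub, show 2 * (t / 2) = t by ring]
  field_simp
  ring

/-- ★★ **THE DICTIONARY**: with `c = (η²)⁻¹`, `lapSymTw K c m² φ q = latticeSymbol η m² (μ ↦ (p′_μ(q) + φ_μ)∕η)` — PART Ͷ-a's twisted fine symbol IS King's (4.4) lattice symbol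
`Δ^η(p) + m²` at the physical momentum shifted by the holonomy. [cite: King1986, (4.4) p.670; Balaban1984PropagatorsI, (1.31) p.23] -/
theorem lapSymTw_eq_latticeSymbol {η : ℝ} (hη : η ≠ 0) (m2 : ℝ) (φ : Fin (d + 1) → ℝ) (q : Tor K) :
    lapSymTw K ((η ^ 2)⁻¹) m2 φ q = latticeSymbol η m2 (fun μ => (sOf K q μ + φ μ) / η) := by
  unfold lapSymTw latticeSymbol
  rw [add_comm, Finset.mul_sum]
  congr 1
  exact Finset.sum_congr rfl fun μ _ => inv_sq_mul_two_sub_two_cos hη _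

/-- The holonomy gap is King's MASSLESS lattice symbol at the momentum `θ_μ∕(ηK_μ) = θ_μ∕ℓ_μ`: `holonomyGap K (η²)⁻¹ θ = latticeSymbol η 0 (μ ↦ θ_μ∕(ηK_μ))`.
[cite: King1986, (4.4) p.670] -/
theorem holonomyGap_eq_latticeSymbol [∀ μ, NeZero (K μ)] {η : ℝ} (hη : η ≠ 0) (θ : Fin (d + 1) → ℝ) :
    holonomyGap K ((η ^ 2)⁻¹) θ = latticeSymbol η 0 (fun μ => θ μ / K μ / η) := by
  have h := lapSymTw_eq_latticeSymbol K hη 0 (redPhase K θ) 0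
  rw [lapSymTw_reduced_zero, zero_add] at h
  rw [h]
  congr 1
  funext μ
  simp [redPhase]

end Dictionary

/-! ## §2 King's (4.7), (4.8), (4.10) at the toron, by name -/
section King47

variable [hK : ∀ μ, NeZero (K μ)]

omit hK in
/-- The Brillouin-zone hypothesis in King's form: `|η·((p′+φ)∕η)_μ| = |p′_μ + φ_μ|`. [folklore] -/
theorem abs_eta_mul_div {η : ℝ} (hη : η ≠ 0) (s : ℝ) : |η * (s / η)| = |s| := by
  rw [mul_div_cancel₀ _ hη]

omit hK in
/-- ★★★ **KING's (4.7) AT THE TORON — THE η-RATE OF THE TWISTED FINE COVARIANCE, MODE BY MODE**: with `c = (η²)⁻¹`, `m² ≥ 0`, for every mode `q` with physical momentum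
`p = (p′(q)+φ)∕η ≠ 0` in the Brillouin zone (`|p′_μ(q) + φ_μ| ≤ π`): `|lapSymTw K c m² φ q⁻¹ − (|p|² + m²)⁻¹| ≤ (π²∕48)·η²`. [cite: King1986, (4.7) p.671, (4.10) p.671] -/
theorem abs_inv_lapSymTw_sub_inv_continuum_le {η : ℝ} (hη : η ≠ 0) {m2 : ℝ} (hm : 0 ≤ m2) (φ : Fin (d + 1) → ℝ) (q : Tor K)
    (hzone : ∀ μ, |sOf K q μ + φ μ| ≤ Real.pi) (hp : 0 < momSq fun μ => (sOf K q μ + φ μ) / η) :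
    |(lapSymTw K ((η ^ 2)⁻¹) m2 φ q)⁻¹ - (momSq (fun μ => (sOf K q μ + φ μ) / η) + m2)⁻¹| ≤ Real.pi ^ 2 / 48 * η ^ 2 := by
  rw [lapSymTw_eq_latticeSymbol K hη]
  exact latticeSymbol_inv_sub_ref_le hη hm (fun μ => by rw [abs_eta_mul_div hη]; exact hzone μ) hp

omit hK in
/-- ★★ KING's (4.8) AT THE TORON: `(4∕π²)|p|² + m² ≤ lapSymTw K (η²)⁻¹ m² φ q` on the Brillouin zone. [cite: King1986, (4.8) p.671] -/
theorem lapSymTw_ge_jordan_momSq {η : ℝ} (hη : η ≠ 0) (m2 : ℝ) (φ : Fin (d + 1) → ℝ) (q : Tor K) (hzone : ∀ μ, |sOf K q μ + φ μ| ≤ Real.pi) :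
    4 / Real.pi ^ 2 * momSq (fun μ => (sOf K q μ + φ μ) / η) + m2 ≤ lapSymTw K ((η ^ 2)⁻¹) m2 φ q := by
  rw [lapSymTw_eq_latticeSymbol K hη]
  exact latticeSymbol_ge_jordan hη m2 fun μ => by rw [abs_eta_mul_div hη]; exact hzone μ

omit hK in
/-- ★★ KING's (4.10) AT THE TORON with the sharp constant: `0 ≤ (|p|² + m²) − lapSymTw ≤ (η²∕12)Σ_μ p_μ⁴` on the Brillouin zone (improving PART Ͷ-d's `5∕48`).
[cite: King1986, (4.10) p.671] -/
theorem abs_lapSymTw_sub_continuum_le' {η : ℝ} (hη : η ≠ 0) (m2 : ℝ) (φ : Fin (d + 1) → ℝ) (q : Tor K) (hzone : ∀ μ, |sOf K q μ + φ μ| ≤ Real.pi) :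
    0 ≤ momSq (fun μ => (sOf K q μ + φ μ) / η) + m2 - lapSymTw K ((η ^ 2)⁻¹) m2 φ q
    ∧ momSq (fun μ => (sOf K q μ + φ μ) / η) + m2 - lapSymTw K ((η ^ 2)⁻¹) m2 φ q ≤ η ^ 2 / 12 * ∑ μ, ((sOf K q μ + φ μ) / η) ^ 4 := by
  rw [lapSymTw_eq_latticeSymbol K hη]
  have h1 := latticeSymbol_le hη m2 (fun μ => (sOf K q μ + φ μ) / η)
  have h2 := latticeSymbol_ge_quartic hη m2 (p := fun μ => (sOf K q μ + φ μ) / η) (fun μ => by rw [abs_eta_mul_div hη]; exact hzone μ)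
  constructor <;> linarith

end King47

/-! ## §3 The inverse holonomy gap: an η-rate uniform in the holonomy -/
section Gap

variable [hK : ∀ μ, NeZero (K μ)]

/-- `|θ_μ| ≤ π ⇒` the momentum `θ∕ℓ` is in the Brillouin zone: `|η·(θ_μ∕(ηK_μ))| = |θ_μ|∕K_μ ≤ π`. [folklore] -/
theorem abs_eta_mul_redPhase_div_le {η : ℝ} (hη : η ≠ 0) {θ : Fin (d + 1) → ℝ} (hθ : ∀ μ, |θ μ| ≤ Real.pi) (μ : Fin (d + 1)) :
    |η * (θ μ / K μ / η)| ≤ Real.pi := by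
  rw [abs_eta_mul_div hη, abs_div, abs_of_pos (period_pos K μ)]
  exact le_trans (div_le_self (abs_nonneg _) (by exact_mod_cast Nat.pos_of_ne_zero (NeZero.ne (K μ)))) (hθ μ)

omit hK in
/-- The continuum gap in King's letters: `momSq(θ∕(ηK)) = (η²)⁻¹·Σ_μ(θ_μ∕K_μ)²`. [folklore] -/
theorem momSq_redPhase_div {η : ℝ} (hη : η ≠ 0) (θ : Fin (d + 1) → ℝ) : momSq (fun μ => θ μ / K μ / η) = (η ^ 2)⁻¹ * ∑ μ, (θ μ / K μ) ^ 2 := by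
  unfold momSq
  rw [Finset.mul_sum]
  exact Finset.sum_congr rfl fun μ _ => by field_simp

/-- ★★★ **THE INVERSE HOLONOMY GAP HAS AN η-RATE UNIFORM IN THE HOLONOMY**: with `c = (η²)⁻¹` and reduced `θ ≠ 0`,
`|holonomyGap K c θ⁻¹ − (c·Σ_μ(θ_μ∕K_μ)²)⁻¹| ≤ (π²∕48)·η²` — King's (4.7) at `M = 0`, `p = θ∕ℓ`: both terms are of infrared size `(ℓ∕θ)²` (PART Ͷ-e), their difference is `O(η²)`
independently of `θ`. [cite: King1986, (4.7) p.671; tHooft1979Flux, NPB 153 (twisted boundary conditions)] -/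
theorem abs_inv_holonomyGap_sub_inv_continuum_le {η : ℝ} (hη : η ≠ 0) {θ : Fin (d + 1) → ℝ} (hθ : ∀ μ, |θ μ| ≤ Real.pi) (hne : θ ≠ 0) :
    |(holonomyGap K ((η ^ 2)⁻¹) θ)⁻¹ - ((η ^ 2)⁻¹ * ∑ μ, (θ μ / K μ) ^ 2)⁻¹| ≤ Real.pi ^ 2 / 48 * η ^ 2 := by
  rw [holonomyGap_eq_latticeSymbol K hη, ← momSq_redPhase_div K hη]
  have hp : 0 < momSq fun μ => θ μ / K μ / η := by
    rw [momSq_redPhase_div K hη]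
    obtain ⟨μ, hμ⟩ := Function.ne_iff.mp hne
    have hx : θ μ / K μ ≠ 0 := div_ne_zero hμ (period_pos K μ).ne'
    exact mul_pos (by positivity) (lt_of_lt_of_le (lt_of_le_of_ne (sq_nonneg _) (Ne.symm (pow_ne_zero 2 hx)))
      (Finset.single_le_sum (fun ν _ => sq_nonneg (θ ν / K ν)) (Finset.mem_univ μ)))
  have h := latticeSymbol_inv_sub_ref_le hη le_rfl (abs_eta_mul_redPhase_div_le K hη hθ) hp
  rwa [add_zero] at h

open scoped Matrix.Norms.L2Operator in
/-- ★★ … hence for the OPERATOR NORM of the massless toron covariance (PART Ͷ-e `l2_opNorm_toronOp_massless_inv_eq`): `|‖(−cΔ_ω)⁻¹‖_{ℓ²→ℓ²} − (cΣ_μ(θ_μ∕K_μ)²)⁻¹| ≤ (π²∕48)·η²`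
(`c = (η²)⁻¹`, reduced `θ ≠ 0`). [cite: King1986, (4.7) p.671; tHooft1979Flux, NPB 153 (twisted boundary conditions)] -/
theorem abs_l2_opNorm_massless_inv_sub_le {η : ℝ} (hη : η ≠ 0) {θ : Fin (d + 1) → ℝ} (hθ : ∀ μ, |θ μ| ≤ Real.pi) (hne : θ ≠ 0) :
    |‖(toronOp K ((η ^ 2)⁻¹) 0 (Literature.MathematicalPhysics.QuantumFieldTheory.Balaban1983to89.B5ToronMomentum161.twistOf (redPhase K θ)))⁻¹‖
        - ((η ^ 2)⁻¹ * ∑ μ, (θ μ / K μ) ^ 2)⁻¹| ≤ Real.pi ^ 2 / 48 * η ^ 2 := by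
  rw [l2_opNorm_toronOp_massless_inv_eq K (by positivity) hθ hne]
  exact abs_inv_holonomyGap_sub_inv_continuum_le K hη hθ hne

end Gap

end Summit.QuantumFields.YangMills.BalabanUVNodes.N15KingModelRung.Toron

end
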